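import Summits.Parity.GeneralizedHardyLittlewood.Theorems.PrimeLevelFamEdgeMomentsBeyondDiagonalDictionaryAtOneBounds
import HarnessLib

/-!
# Route `PrimeLevelFamEdge`, crux K_A `MomentsBeyondDiagonal` (stmt-Parity-20007), line «petersson_layers» v4:
# THE IDENTIFICATION AT `Q = 1` — `TAIL(ρ) + FAR(ρ) = O(1)`, i.e. the `Q = 1` slice of `stub_identP : TailNearFar ρ_P`
# (lead prover, 2026-08-28; helper)

With the exact dictionary (`QhPQ_one_eq_tsum_pet`, deck file `…DictionaryAtOne`) and the elementary bounds of `…DictionaryAtOneBounds`,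
this file passes to the FINITE explicit pieces of deck 21a at `Q = 1`:
* §1 `diagPart − Σ_{r ≤ R} layer r` is ONE spectral sum, against the kernel `δ(a,b) − Σ_{r≤R} (2π/q) r⁻¹S(a,b;qr)J₁(…)`
  (`diagPart_sub_sum_layer_one`);
* §2 inside the box, Petersson's formula leaves exactly the layer tail: `Σʰλ_f(a)λ_f(b) − [δ(a,b) − Σ_{r≤R} K_r(a,b)] =
  −Σ_{r>R} K_r(a,b)` (`pet_sub_kernel_eq_neg_tsum`), and that tail is `≪ √(a,b)√(ab) q^{−3/2} (R+1)^{−2/5}` (Weil);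
* §3 the two truncation errors — pairs `(n₁,n₂)` outside the box `nᵢ ≤ q²` (where `W(n₁n₂/q̂²) ≤ e^{−π√q}`·poly) and layers
  `r > q⁸` — are bounded by constants depending on `P` only;
* §4 hence for every cut `ρ ≤ 8` on `(1, 3/2]`, every `P` and every `Δ' ∈ (1, 3/2]`:
  `‖tail q ρ P 1 Δ' + farLayers q ρ P 1 Δ'‖ ≤ C_P ≤ 27 C_P · q̂ (log q̂)⁻³` for all large primes `q`
  (`tailNearFar_atOne`): the `Q = 1` slice of the registered identification stub, PROVED. The `Q ≠ 1` slices wait on the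
  all-orders AFE `kmv2000_eq22` (typed, only `k = 0` proved). No moment ASYMPTOTIC, no stub as registered (all `Q`), and nothing
  about K_A / `stub_core` is proved here; no exceptional-zero claim (no GRH, no Landau–Siegel).
-/

noncomputable section

open scoped MatrixGroups Real Nat
open CongruenceSubgroup Complex Finset Polynomial MeasureTheory
open Literature.NumberTheory.EllipticCurves.ModularForms
open Literature.NumberTheory.LFunctions

namespace Summit.Parity.GeneralizedHardyLittlewood.Theorems.PrimeLevelFamEdgeIdeaDeltas.PeterssonLayers

/-! ## §1. `D − Σ_{r ≤ R} K_r` as one spectral sum at `Q = 1` -/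

/-- Membership in the AFE box gives `n ≠ 0`. -/
theorem ne_zero_of_mem_afeBox {q n : ℕ} (hn : n ∈ afeBox q) : n ≠ 0 := by
  rw [afeBox, Finset.mem_Icc] at hn
  omega

/-- **§1.** At `Q = 1`: `diagPart − Σ_{r∈[1,R]} layer r = 2q̂ Σ_{n₁,n₂ ≤ q²} (n₁n₂)^{−1/2} W(n₁n₂/q̂²) Σ_{m₁,m₂ ≤ M}
x_{m₁}x_{m₂} Σ_{d₁,d₂} [δ(a,b) − Σ_{r ≤ R} (2π/q)·r⁻¹S(a,b;qr)J₁(4π√(ab)/(qr))]` (kernel-linearity of `spectralSum`, its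
`i = j = 0` slice, and `W₀₀ = W` in the box). -/
theorem diagPart_sub_sum_layer_one (q : ℕ) [NeZero q] (P : ℝ[X]) (Δ' : ℝ) (R : ℕ) :
    diagPart q P 1 Δ' - ∑ r ∈ Icc 1 R, layer q P 1 Δ' r =
      2 * (KMV2000.qhat q : ℂ) *
      ∑ n₁ ∈ afeBox q, ∑ n₂ ∈ afeBox q,
        ((((n₁ : ℝ) * n₂) ^ (-(1 / 2 : ℝ)) : ℝ) : ℂ) *
          ((KMV2000.cutoffW ((n₁ : ℝ) * n₂ / KMV2000.qhat q ^ 2) : ℝ) : ℂ) *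
        ∑ m₁ ∈ Icc 1 ⌊KMV2000.qhat q ^ Δ'⌋₊, ∑ m₂ ∈ Icc 1 ⌊KMV2000.qhat q ^ Δ'⌋₊,
          (KMV2000.mollifierCoeff P (KMV2000.qhat q ^ Δ') m₁ : ℂ) *
            (KMV2000.mollifierCoeff P (KMV2000.qhat q ^ Δ') m₂ : ℂ) *
          ∑ d₁ ∈ (Nat.gcd m₁ n₁).divisors, ∑ d₂ ∈ (Nat.gcd m₂ n₂).divisors,
            (diagKernel (m₁ * n₁ / d₁ ^ 2) (m₂ * n₂ / d₂ ^ 2) -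
              ∑ r ∈ Icc 1 R, layerKernel q r (m₁ * n₁ / d₁ ^ 2) (m₂ * n₂ / d₂ ^ 2)) := by
  unfold diagPart layer
  rw [← spectralSum_kernel_finset_sum, ← spectralSum_kernel_sub, spectralSum_one]
  congr 1
  refine Finset.sum_congr rfl fun n₁ hn₁ ↦ Finset.sum_congr rfl fun n₂ hn₂ ↦ ?_
  rw [afeW_zero_zero q (ne_zero_of_mem_afeBox hn₁) (ne_zero_of_mem_afeBox hn₂)]

/-! ## §2. Inside the box: Petersson leaves the layer tail -/

/-- The layer kernels form an absolutely convergent series in `r` (Weil; the clause of Petersson's formula). -/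
theorem summable_layerKernel {q : ℕ} [NeZero q] (hq : q.Prime) {a b : ℕ} (ha : 1 ≤ a) (hb : 1 ≤ b) :
    Summable (fun r : ℕ ↦ layerKernel q r a b) := by
  have hsum := (KowalskiMichel2000.kowalskiMichel2000_peterssonFormula_holds q hq a b ha hb).1
  unfold layerKernel
  exact hsum.of_norm.mul_left _

/-- `J(a,b) = Σ'_r K_r(a,b)` (Kowalski–Michel's off-diagonal term is the full layer series). -/
theorem petJ_eq_tsum_layerKernel (q : ℕ) [NeZero q] (a b : ℕ) :
    KowalskiMichel2000.petJ q a b = ∑' r : ℕ, layerKernel q r a b := by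
  rw [KowalskiMichel2000.petJ_def]
  unfold layerKernel
  rw [tsum_mul_left]

/-- The finite layer sum over `[1, R]` is the one over `range (R+1)` (the `r = 0` kernel vanishes). -/
theorem sum_range_layerKernel (q : ℕ) [NeZero q] (a b R : ℕ) :
    ∑ r ∈ range (R + 1), layerKernel q r a b = ∑ r ∈ Icc 1 R, layerKernel q r a b := by
  have h0 : layerKernel q 0 a b = 0 := by simp [layerKernel]
  rw [Finset.range_eq_Ico, Finset.sum_eq_sum_Ico_succ_bot (by omega), h0, zero_add, zero_add,
    Finset.Ico_add_one_right_eq_Icc]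

/-- **§2.** For `q` prime and `a, b ≥ 1`: `Σʰλ_f(a)λ_f(b) − [δ(a,b) − Σ_{1≤r≤R} K_r(a,b)] = −Σ_{k≥0} K_{k+R+1}(a,b)`
(Petersson's formula `Σʰλλ = δ − Σ_{r≥1}K_r`, the series split at `R`). -/
theorem pet_sub_kernel_eq_neg_tsum {q : ℕ} [NeZero q] (hq : q.Prime) {a b : ℕ} (ha : 1 ≤ a) (hb : 1 ≤ b) (R : ℕ) :
    KowalskiMichel2000.pet q a b - (diagKernel a b - ∑ r ∈ Icc 1 R, layerKernel q r a b) =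
      -∑' k : ℕ, layerKernel q (k + (R + 1)) a b := by
  have hpet := (KowalskiMichel2000.kowalskiMichel2000_peterssonFormula_holds q hq a b ha hb).2
  have hsplit := (summable_layerKernel hq ha hb).sum_add_tsum_nat_add (R + 1)
  rw [sum_range_layerKernel] at hsplit
  rw [hpet, petJ_eq_tsum_layerKernel, ← hsplit, diagKernel]
  ring

/-- **The layer tail beyond `R` is small (Weil):** there is `A ≥ 0` with
`‖Σ_{k≥0} K_{k+R+1}(a,b)‖ ≤ A √(a,b) √(ab) q^{−3/2} (R+1)^{−2/5}` for all primes `q`, `a ≥ 1`, `b`, `R`. -/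
theorem exists_norm_tsum_layerKernel_tail_le :
    ∃ A : ℝ, 0 ≤ A ∧ ∀ (q : ℕ) [NeZero q], q.Prime → ∀ a b R : ℕ, 1 ≤ a →
      ‖∑' k : ℕ, layerKernel q (k + (R + 1)) a b‖ ≤
        A * Real.sqrt ((a.gcd b : ℕ) : ℝ) * Real.sqrt ((a : ℝ) * b) * (q : ℝ) ^ (-(3 / 2 : ℝ)) *
          (((R + 1 : ℕ) : ℝ)) ^ (-(2 / 5 : ℝ)) := by
  obtain ⟨C, hC1, hC⟩ :=
    Literature.NumberTheory.Sieve.exists_card_divisors_le_mul_rpow' (by norm_num : (0 : ℝ) < 1 / 20)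
  have hC0 : 0 ≤ C := zero_le_one.trans hC1
  set Z : ℝ := ∑' k : ℕ, (((k + 1 : ℕ) : ℝ)) ^ (-(21 / 20 : ℝ)) with hZ
  have hZ0 : 0 ≤ Z := tsum_nonneg fun k ↦ Real.rpow_nonneg (Nat.cast_nonneg _) _
  refine ⟨2 * π * (4 * π * C) * Z, by positivity, fun q _ hq a b R ha ↦ ?_⟩
  have hq0 : (0 : ℝ) < q := by exact_mod_cast hq.pos
  -- termwise bound with `r^{-29/20}` and its sum
  obtain ⟨hS, hT⟩ := tsum_shift_rpow_le R
  set Y : ℝ := 4 * π * C * Real.sqrt ((a.gcd b : ℕ) : ℝ) * Real.sqrt ((a : ℝ) * b) * (q : ℝ) ^ (-(1 / 2 : ℝ)) with hY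
  have hY0 : 0 ≤ Y := by positivity
  have hterm : ∀ k : ℕ, ‖layerKernel q (k + (R + 1)) a b‖ ≤
      (2 * π / q) * (Y * (((k + R + 1 : ℕ) : ℝ)) ^ (-(29 / 20 : ℝ))) := by
    intro k
    have hk : k + (R + 1) ≠ 0 := by omega
    have h := norm_petKloostermanTerm_le_rpow hq (b := b) ha (ε := 1 / 20) hC (k + (R + 1)) hk
    have e : (-(3 / 2 - 1 / 20 : ℝ)) = -(29 / 20 : ℝ) := by norm_num
    rw [e] at h
    have hcast : (((k + (R + 1) : ℕ) : ℝ)) = (((k + R + 1 : ℕ) : ℝ)) := by push_cast; ring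
    rw [hcast] at h
    unfold layerKernel
    rw [norm_mul]
    have hn : ‖(2 * (π : ℂ) / (q : ℂ))‖ = 2 * π / q := by
      rw [norm_div, norm_mul, Complex.norm_ofNat, Complex.norm_real, Complex.norm_natCast, Real.norm_eq_abs,
        abs_of_pos Real.pi_pos]
    rw [hn]
    exact mul_le_mul_of_nonneg_left (by rw [hY]; exact h) (by positivity)
  have hmaj : Summable (fun k : ℕ ↦ (2 * π / q) * (Y * (((k + R + 1 : ℕ) : ℝ)) ^ (-(29 / 20 : ℝ)))) :=
    (hS.mul_left Y).mul_left _
  have hns : Summable (fun k : ℕ ↦ ‖layerKernel q (k + (R + 1)) a b‖) :=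
    Summable.of_nonneg_of_le (fun _ ↦ norm_nonneg _) hterm hmaj
  calc ‖∑' k : ℕ, layerKernel q (k + (R + 1)) a b‖
      ≤ ∑' k : ℕ, ‖layerKernel q (k + (R + 1)) a b‖ := norm_tsum_le_tsum_norm hns
    _ ≤ ∑' k : ℕ, (2 * π / q) * (Y * (((k + R + 1 : ℕ) : ℝ)) ^ (-(29 / 20 : ℝ))) :=
        Summable.tsum_le_tsum hterm hns hmaj
    _ = (2 * π / q) * (Y * ∑' k : ℕ, (((k + R + 1 : ℕ) : ℝ)) ^ (-(29 / 20 : ℝ))) := by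
        rw [tsum_mul_left, tsum_mul_left]
    _ ≤ (2 * π / q) * (Y * (Z * (((R + 1 : ℕ) : ℝ)) ^ (-(2 / 5 : ℝ)))) := by
        gcongr
    _ = 2 * π * (4 * π * C) * Z * Real.sqrt ((a.gcd b : ℕ) : ℝ) * Real.sqrt ((a : ℝ) * b) *
          ((q : ℝ)⁻¹ * (q : ℝ) ^ (-(1 / 2 : ℝ))) * (((R + 1 : ℕ) : ℝ)) ^ (-(2 / 5 : ℝ)) := by
        rw [hY]; ring
    _ = _ := by
        rw [← Real.rpow_neg_one, ← Real.rpow_add hq0]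
        norm_num

/-! ## §3. Sizes of the explicit sums -/

/-- `√(a,b) · √(ab) ≤ (ab)^{3/4}` for `a, b ≥ 1` (`(a,b)² ≤ ab`). -/
theorem sqrt_gcd_mul_sqrt_le {a b : ℕ} (ha : 1 ≤ a) (hb : 1 ≤ b) :
    Real.sqrt ((a.gcd b : ℕ) : ℝ) * Real.sqrt ((a : ℝ) * b) ≤ (((a : ℝ) * b)) ^ (3 / 4 : ℝ) := by
  have ha0 : (0 : ℝ) < a := by exact_mod_cast ha
  have hb0 : (0 : ℝ) < b := by exact_mod_cast hb
  have hab : (0 : ℝ) < (a : ℝ) * b := mul_pos ha0 hb0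
  have hg : ((a.gcd b : ℕ) : ℝ) ≤ Real.sqrt ((a : ℝ) * b) := by
    have h1 : ((a.gcd b : ℕ) : ℝ) ≤ a := by exact_mod_cast Nat.gcd_le_left b ha
    have h2 : ((a.gcd b : ℕ) : ℝ) ≤ b := by exact_mod_cast Nat.le_of_dvd (by omega) (Nat.gcd_dvd_right a b)
    have hg0 : (0 : ℝ) ≤ ((a.gcd b : ℕ) : ℝ) := Nat.cast_nonneg _
    rw [Real.le_sqrt hg0 hab.le]
    calc ((a.gcd b : ℕ) : ℝ) ^ 2 = ((a.gcd b : ℕ) : ℝ) * ((a.gcd b : ℕ) : ℝ) := sq _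
      _ ≤ (a : ℝ) * b := mul_le_mul h1 h2 hg0 ha0.le
  have e1 : Real.sqrt (Real.sqrt ((a : ℝ) * b)) = ((a : ℝ) * b) ^ (1 / 4 : ℝ) := by
    rw [Real.sqrt_eq_rpow, Real.sqrt_eq_rpow, ← Real.rpow_mul hab.le]; norm_num
  have e2 : Real.sqrt ((a : ℝ) * b) = ((a : ℝ) * b) ^ (1 / 2 : ℝ) := Real.sqrt_eq_rpow _
  calc Real.sqrt ((a.gcd b : ℕ) : ℝ) * Real.sqrt ((a : ℝ) * b)
      ≤ Real.sqrt (Real.sqrt ((a : ℝ) * b)) * Real.sqrt ((a : ℝ) * b) := by gcongr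
    _ = ((a : ℝ) * b) ^ (1 / 4 : ℝ) * ((a : ℝ) * b) ^ (1 / 2 : ℝ) := by rw [e1, e2]
    _ = ((a : ℝ) * b) ^ (3 / 4 : ℝ) := by rw [← Real.rpow_add hab]; norm_num

/-- `Σ_{1 ≤ m ≤ ⌊M⌋} m^e ≤ M^{e+1}` for `M ≥ 1`, `e ≥ 0`. -/
theorem sum_Icc_rpow_le {M e : ℝ} (hM : 1 ≤ M) (he : 0 ≤ e) :
    ∑ m ∈ Icc 1 ⌊M⌋₊, ((m : ℝ)) ^ e ≤ M ^ (e + 1) := by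
  have hM0 : 0 ≤ M := zero_le_one.trans hM
  have hpt : ∀ m ∈ Icc 1 ⌊M⌋₊, ((m : ℝ)) ^ e ≤ M ^ e := by
    intro m hm
    rw [Finset.mem_Icc] at hm
    have hmM : (m : ℝ) ≤ M := le_trans (by exact_mod_cast hm.2) (Nat.floor_le hM0)
    exact Real.rpow_le_rpow (Nat.cast_nonneg _) hmM he
  calc ∑ m ∈ Icc 1 ⌊M⌋₊, ((m : ℝ)) ^ e ≤ ∑ m ∈ Icc 1 ⌊M⌋₊, M ^ e := Finset.sum_le_sum hpt
    _ = (⌊M⌋₊ : ℝ) * M ^ e := by rw [Finset.sum_const, Nat.card_Icc, Nat.add_sub_cancel, nsmul_eq_mul]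
    _ ≤ M * M ^ e := by gcongr; exact Nat.floor_le hM0
    _ = M ^ (e + 1) := by rw [Real.rpow_add (by linarith), Real.rpow_one]; ring

/-- `τ((m,n)) ≤ τ(m)` for `m ≥ 1` (divisors of the gcd are divisors of `m`). -/
theorem card_divisors_gcd_le {m : ℕ} (hm : 1 ≤ m) (n : ℕ) :
    (Nat.gcd m n).divisors.card ≤ m.divisors.card :=
  Finset.card_le_card (Nat.divisors_subset_of_dvd (by omega) (Nat.gcd_dvd_left m n))

/-- **The mollifier pair sum against a kernel of polynomial size.** If `‖G(a,b)‖ ≤ c·(ab)^θ` on the pairs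
`a = m₁n₁/d₁², b = m₂n₂/d₂²` (`θ ≥ 0`), then
`‖Σ_{m₁,m₂ ≤ M} x_{m₁}x_{m₂} Σ_{d₁∣(m₁,n₁)} Σ_{d₂∣(m₂,n₂)} G(a,b)‖ ≤ c·B²·C²·(n₁n₂)^θ·(Σ_{m ≤ M} m^{θ−1/2+1/20})²`
(`|x_m| ≤ B m^{−1/2}`, `τ((m,n)) ≤ τ(m) ≤ C m^{1/20}`, `a ≤ m₁n₁`, `b ≤ m₂n₂`). -/
theorem norm_mollifierPairSum_le {P : ℝ[X]} {B C θ c M : ℝ} (hB : ∀ t ∈ Set.Icc (0 : ℝ) 1, |P.eval t| ≤ B)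
    (hM : 1 < M) (hC : ∀ r : ℕ, ((r.divisors.card : ℕ) : ℝ) ≤ C * (r : ℝ) ^ (1 / 20 : ℝ)) (hθ : 0 ≤ θ)
    (hc : 0 ≤ c) (n₁ n₂ : ℕ) (G : ℕ → ℕ → ℂ)
    (hG : ∀ m₁ ∈ Icc 1 ⌊M⌋₊, ∀ m₂ ∈ Icc 1 ⌊M⌋₊, ∀ d₁ ∈ (Nat.gcd m₁ n₁).divisors, ∀ d₂ ∈ (Nat.gcd m₂ n₂).divisors,
      ‖G (m₁ * n₁ / d₁ ^ 2) (m₂ * n₂ / d₂ ^ 2)‖ ≤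
        c * ((((m₁ * n₁ / d₁ ^ 2 : ℕ) : ℝ)) * ((m₂ * n₂ / d₂ ^ 2 : ℕ) : ℝ)) ^ θ) :
    ‖∑ m₁ ∈ Icc 1 ⌊M⌋₊, ∑ m₂ ∈ Icc 1 ⌊M⌋₊,
        (KMV2000.mollifierCoeff P M m₁ : ℂ) * (KMV2000.mollifierCoeff P M m₂ : ℂ) *
        ∑ d₁ ∈ (Nat.gcd m₁ n₁).divisors, ∑ d₂ ∈ (Nat.gcd m₂ n₂).divisors,
          G (m₁ * n₁ / d₁ ^ 2) (m₂ * n₂ / d₂ ^ 2)‖ ≤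
      c * B ^ 2 * C ^ 2 * (((n₁ : ℝ) * n₂) ^ θ) *
        (∑ m ∈ Icc 1 ⌊M⌋₊, ((m : ℝ)) ^ (θ - 1 / 2 + 1 / 20)) ^ 2 := by
  have hB0 : 0 ≤ B := le_trans (abs_nonneg _) (hB 0 (by simp))
  have hC0 : 0 ≤ C := by have h := hC 1; simp at h; linarith
  have hn : 0 ≤ ((n₁ : ℝ) * n₂) := by positivity
  -- termwise bound
  have hpt : ∀ m₁ ∈ Icc 1 ⌊M⌋₊, ∀ m₂ ∈ Icc 1 ⌊M⌋₊,
      ‖(KMV2000.mollifierCoeff P M m₁ : ℂ) * (KMV2000.mollifierCoeff P M m₂ : ℂ) *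
        ∑ d₁ ∈ (Nat.gcd m₁ n₁).divisors, ∑ d₂ ∈ (Nat.gcd m₂ n₂).divisors,
          G (m₁ * n₁ / d₁ ^ 2) (m₂ * n₂ / d₂ ^ 2)‖ ≤
        c * B ^ 2 * C ^ 2 * (((n₁ : ℝ) * n₂) ^ θ) *
          (((m₁ : ℝ)) ^ (θ - 1 / 2 + 1 / 20) * ((m₂ : ℝ)) ^ (θ - 1 / 2 + 1 / 20)) := by
    intro m₁ hm₁ m₂ hm₂
    have hm₁' := Finset.mem_Icc.mp hm₁
    have hm₂' := Finset.mem_Icc.mp hm₂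
    have hm₁0 : (0 : ℝ) < m₁ := by exact_mod_cast hm₁'.1
    have hm₂0 : (0 : ℝ) < m₂ := by exact_mod_cast hm₂'.1
    have hx₁ := norm_mollifierCoeff_le hB hM hm₁
    have hx₂ := norm_mollifierCoeff_le hB hM hm₂
    -- the divisor double sum
    have hdd : ‖∑ d₁ ∈ (Nat.gcd m₁ n₁).divisors, ∑ d₂ ∈ (Nat.gcd m₂ n₂).divisors,
        G (m₁ * n₁ / d₁ ^ 2) (m₂ * n₂ / d₂ ^ 2)‖ ≤
        (C * (m₁ : ℝ) ^ (1 / 20 : ℝ)) * (C * (m₂ : ℝ) ^ (1 / 20 : ℝ)) *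
          (c * ((((m₁ : ℝ) * n₁) * ((m₂ : ℝ) * n₂)) ^ θ)) := by
      have hG' : ∀ d₁ ∈ (Nat.gcd m₁ n₁).divisors, ∀ d₂ ∈ (Nat.gcd m₂ n₂).divisors,
          ‖G (m₁ * n₁ / d₁ ^ 2) (m₂ * n₂ / d₂ ^ 2)‖ ≤ c * ((((m₁ : ℝ) * n₁) * ((m₂ : ℝ) * n₂)) ^ θ) := by
        intro d₁ hd₁ d₂ hd₂
        refine (hG m₁ hm₁ m₂ hm₂ d₁ hd₁ d₂ hd₂).trans ?_
        gcongr
        · exact_mod_cast Nat.div_le_self _ _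
        · exact_mod_cast Nat.div_le_self _ _
      calc ‖∑ d₁ ∈ (Nat.gcd m₁ n₁).divisors, ∑ d₂ ∈ (Nat.gcd m₂ n₂).divisors,
            G (m₁ * n₁ / d₁ ^ 2) (m₂ * n₂ / d₂ ^ 2)‖
          ≤ ∑ d₁ ∈ (Nat.gcd m₁ n₁).divisors, ‖∑ d₂ ∈ (Nat.gcd m₂ n₂).divisors,
              G (m₁ * n₁ / d₁ ^ 2) (m₂ * n₂ / d₂ ^ 2)‖ := norm_sum_le _ _
        _ ≤ ∑ d₁ ∈ (Nat.gcd m₁ n₁).divisors, ∑ d₂ ∈ (Nat.gcd m₂ n₂).divisors,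
              ‖G (m₁ * n₁ / d₁ ^ 2) (m₂ * n₂ / d₂ ^ 2)‖ := Finset.sum_le_sum fun _ _ ↦ norm_sum_le _ _
        _ ≤ ∑ d₁ ∈ (Nat.gcd m₁ n₁).divisors, ∑ d₂ ∈ (Nat.gcd m₂ n₂).divisors,
              c * ((((m₁ : ℝ) * n₁) * ((m₂ : ℝ) * n₂)) ^ θ) :=
            Finset.sum_le_sum fun d₁ hd₁ ↦ Finset.sum_le_sum fun d₂ hd₂ ↦ hG' d₁ hd₁ d₂ hd₂
        _ = ((Nat.gcd m₁ n₁).divisors.card : ℝ) * ((Nat.gcd m₂ n₂).divisors.card : ℝ) *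
              (c * ((((m₁ : ℝ) * n₁) * ((m₂ : ℝ) * n₂)) ^ θ)) := by
            rw [Finset.sum_const, Finset.sum_const, nsmul_eq_mul, nsmul_eq_mul]; ring
        _ ≤ (C * (m₁ : ℝ) ^ (1 / 20 : ℝ)) * (C * (m₂ : ℝ) ^ (1 / 20 : ℝ)) *
              (c * ((((m₁ : ℝ) * n₁) * ((m₂ : ℝ) * n₂)) ^ θ)) := by
            have h1 : ((Nat.gcd m₁ n₁).divisors.card : ℝ) ≤ C * (m₁ : ℝ) ^ (1 / 20 : ℝ) :=
              le_trans (by exact_mod_cast card_divisors_gcd_le hm₁'.1 n₁) (hC m₁)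
            have h2 : ((Nat.gcd m₂ n₂).divisors.card : ℝ) ≤ C * (m₂ : ℝ) ^ (1 / 20 : ℝ) :=
              le_trans (by exact_mod_cast card_divisors_gcd_le hm₂'.1 n₂) (hC m₂)
            gcongr
    rw [norm_mul, norm_mul]
    calc ‖(KMV2000.mollifierCoeff P M m₁ : ℂ)‖ * ‖(KMV2000.mollifierCoeff P M m₂ : ℂ)‖ *
          ‖∑ d₁ ∈ (Nat.gcd m₁ n₁).divisors, ∑ d₂ ∈ (Nat.gcd m₂ n₂).divisors,
            G (m₁ * n₁ / d₁ ^ 2) (m₂ * n₂ / d₂ ^ 2)‖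
        ≤ (B * (m₁ : ℝ) ^ (-(1 / 2 : ℝ))) * (B * (m₂ : ℝ) ^ (-(1 / 2 : ℝ))) *
            ((C * (m₁ : ℝ) ^ (1 / 20 : ℝ)) * (C * (m₂ : ℝ) ^ (1 / 20 : ℝ)) *
              (c * ((((m₁ : ℝ) * n₁) * ((m₂ : ℝ) * n₂)) ^ θ))) := by
          gcongr
      _ = c * B ^ 2 * C ^ 2 * (((n₁ : ℝ) * n₂) ^ θ) *
            (((m₁ : ℝ)) ^ (θ - 1 / 2 + 1 / 20) * ((m₂ : ℝ)) ^ (θ - 1 / 2 + 1 / 20)) := by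
          have e : ((((m₁ : ℝ) * n₁) * ((m₂ : ℝ) * n₂)) ^ θ) =
              (m₁ : ℝ) ^ θ * (m₂ : ℝ) ^ θ * (((n₁ : ℝ) * n₂) ^ θ) := by
            rw [show ((m₁ : ℝ) * n₁) * ((m₂ : ℝ) * n₂) = ((m₁ : ℝ) * m₂) * ((n₁ : ℝ) * n₂) by ring,
              Real.mul_rpow (by positivity) hn, Real.mul_rpow hm₁0.le hm₂0.le]
          have e₁ : ((m₁ : ℝ)) ^ (θ - 1 / 2 + 1 / 20) =
              (m₁ : ℝ) ^ (-(1 / 2 : ℝ)) * (m₁ : ℝ) ^ (1 / 20 : ℝ) * (m₁ : ℝ) ^ θ := by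
            rw [← Real.rpow_add hm₁0, ← Real.rpow_add hm₁0]; ring_nf
          have e₂ : ((m₂ : ℝ)) ^ (θ - 1 / 2 + 1 / 20) =
              (m₂ : ℝ) ^ (-(1 / 2 : ℝ)) * (m₂ : ℝ) ^ (1 / 20 : ℝ) * (m₂ : ℝ) ^ θ := by
            rw [← Real.rpow_add hm₂0, ← Real.rpow_add hm₂0]; ring_nf
          rw [e, e₁, e₂]; ring
  calc ‖∑ m₁ ∈ Icc 1 ⌊M⌋₊, ∑ m₂ ∈ Icc 1 ⌊M⌋₊,
        (KMV2000.mollifierCoeff P M m₁ : ℂ) * (KMV2000.mollifierCoeff P M m₂ : ℂ) *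
        ∑ d₁ ∈ (Nat.gcd m₁ n₁).divisors, ∑ d₂ ∈ (Nat.gcd m₂ n₂).divisors,
          G (m₁ * n₁ / d₁ ^ 2) (m₂ * n₂ / d₂ ^ 2)‖
      ≤ ∑ m₁ ∈ Icc 1 ⌊M⌋₊, ∑ m₂ ∈ Icc 1 ⌊M⌋₊,
          ‖(KMV2000.mollifierCoeff P M m₁ : ℂ) * (KMV2000.mollifierCoeff P M m₂ : ℂ) *
            ∑ d₁ ∈ (Nat.gcd m₁ n₁).divisors, ∑ d₂ ∈ (Nat.gcd m₂ n₂).divisors,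
              G (m₁ * n₁ / d₁ ^ 2) (m₂ * n₂ / d₂ ^ 2)‖ :=
        (norm_sum_le _ _).trans (Finset.sum_le_sum fun _ _ ↦ norm_sum_le _ _)
    _ ≤ ∑ m₁ ∈ Icc 1 ⌊M⌋₊, ∑ m₂ ∈ Icc 1 ⌊M⌋₊, c * B ^ 2 * C ^ 2 * (((n₁ : ℝ) * n₂) ^ θ) *
          (((m₁ : ℝ)) ^ (θ - 1 / 2 + 1 / 20) * ((m₂ : ℝ)) ^ (θ - 1 / 2 + 1 / 20)) :=
        Finset.sum_le_sum fun m₁ hm₁ ↦ Finset.sum_le_sum fun m₂ hm₂ ↦ hpt m₁ hm₁ m₂ hm₂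
    _ = c * B ^ 2 * C ^ 2 * (((n₁ : ℝ) * n₂) ^ θ) *
          (∑ m ∈ Icc 1 ⌊M⌋₊, ((m : ℝ)) ^ (θ - 1 / 2 + 1 / 20)) ^ 2 := by
        rw [pow_two (∑ m ∈ Icc 1 ⌊M⌋₊, ((m : ℝ)) ^ (θ - 1 / 2 + 1 / 20)), Finset.sum_mul_sum, Finset.mul_sum]
        refine Finset.sum_congr rfl fun m₁ _ ↦ ?_
        rw [Finset.mul_sum]

end Summit.Parity.GeneralizedHardyLittlewood.Theorems.PrimeLevelFamEdgeIdeaDeltas.PeterssonLayers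

end
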